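import Literature.Probability.LatticeModels.RandomWalkLoopMeasure
import HarnessLib

/-!
# Restriction of the random-walk loop measure to a subgraph: the escaping loop mass

Topic `Probability/LatticeModels`; rider for definition item `defn-LoopAvoidanceRegularisedLaw`
(route CriticalPhenomena/SAWLoopAvoidanceChaos, crux `ChaosRestriction`, stmt-CriticalPhenomena-4524).

Setting of `RandomWalkLoopMeasure.lean`: `G` a subgraph of `ℤ²` (`Site 2`), rooted loops of `G` =
closed walks `Σ x, G.Walk x x`, rooted loop weight `m̃(l) = (1/4)^{|l|}/|l|` (Lawler 2018, Def. 8),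
`rwLoopMass G W = m[ℒ(G; W)]` the mass of the loops of positive length meeting `W`.

**Restriction property.** For a subgraph `G' ≤ G` (same vertex type, fewer edges — e.g. the
discrete domains `Ω'_ε ≤ Ω_ε` of nested planar domains when the discretisations are nested) the
rooted loops of `G'` ARE the rooted loops of `G` all of whose edges are edges of `G'`, with the same
weight (the weight `q(l)/|l|` of Def. 8 does not refer to the ambient graph). Hence, whenever the
loop series of `G` converges,

  `m[ℒ(G; W)] = m[ℒ(G'; W)] + m[{l ∈ ℒ(G; W) : l ⊄ G'}]`     (`rwLoopMass_eq_add_rwLoopMassEscaping`)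

where the last term, `rwLoopMassEscaping G G' W`, is the mass of the loops of `G` meeting `W` that
use at least one edge outside `G'` ("escaping" loops). Exponentiating: the soup-void probabilities
satisfy `void_{G'}(W) = exp (m_esc) · void_G(W)` (`loopSoupVoid_eq_exp_mul_of_le`) — the probability
that the unit random-walk loop soup on the SMALLER graph misses `W` exceeds that on the larger graph
exactly by the exponential of the escaping mass. Combined with the counterterm cancellation
`LoopAvoidance.dens_div_dens_of_hit_eq` (file `RandomPlanarGeometry/LoopAvoidanceRegularisedLaw`)
this is the mesoscopic restriction identity behind crux `ChaosRestriction`: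
`dens^{D'}_ε(γ) / dens^{D}_ε(γ) = exp (m_esc(Ω_ε, Ω'_ε; hit_ε γ))` when the hit sets agree and
`Ω'_ε ≤ Ω_ε`.

Contents: `rootedLoopOfLE h` (the inclusion of rooted loops along `h : G' ≤ G`, via Mathlib's
`SimpleGraph.Walk.mapLe`), its injectivity, the description of its range (`Walk.transfer`), the
invariance of the loop weight, `rwLoopMassEscaping` and the splitting/monotonicity/void identities.
All sums are real `tsum`s; the splitting needs `Summable (rwLoopTerm G W)` (true on finite killed
domains — not proved in this file), monotonicity of summability along `G' ≤ G` is proved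
(`summable_rwLoopTerm_of_le`).

## References

* G. F. Lawler, *Topics in loop measures and the loop-erased walk*, Probab. Surveys 15 (2018),
  arXiv:1709.07531: Def. 8 (rooted loop measure), Def. 9–10 (`ℒ(A; B)`), §5.2 Def. 12 (soups).
  [Lawler2018]
* G. F. Lawler, J. Trujillo Ferreras, *Random walk loop soup*, TAMS 359 (2007). [LawlerTrujilloferreras2006]
* G. F. Lawler, W. Werner, *The Brownian loop soup*, PTRF 128 (2004) (restriction property of the
  Brownian loop measure, the continuum counterpart). [LawlerWerner2004]
-/

noncomputable section

open SimpleGraph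
open scoped Classical

namespace Literature.Probability.LatticeModels

variable {G G' : SimpleGraph (Site 2)}

/-! ### Rooted loops of a subgraph as rooted loops of the graph -/

/-- The inclusion of the rooted loops of a subgraph `G' ≤ G` into the rooted loops of `G` (same
root, same vertex sequence; Mathlib's `Walk.mapLe`). Restriction property of the loop measure
(Lawler 2018, Def. 8: the weight of a loop does not refer to the ambient graph). [folklore] -/
def rootedLoopOfLE (h : G' ≤ G) : (Σ x : Site 2, G'.Walk x x) → (Σ x : Site 2, G.Walk x x) :=
  Sigma.map id fun _ w => w.mapLe h

/-- `rootedLoopOfLE` on a rooted loop `⟨x, w⟩`. [folklore] -/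
@[simp] theorem rootedLoopOfLE_mk (h : G' ≤ G) (x : Site 2) (w : G'.Walk x x) :
    rootedLoopOfLE h ⟨x, w⟩ = ⟨x, w.mapLe h⟩ := rfl

/-- The inclusion of rooted loops is injective. [folklore] -/
theorem rootedLoopOfLE_injective (h : G' ≤ G) : Function.Injective (rootedLoopOfLE h) :=
  Function.injective_id.sigma_map fun x =>
    Walk.map_injective_of_injective (f := Hom.ofLE h) (fun _ _ hab => hab) x x

/-- A rooted loop of `G` comes from `G'` iff all its edges are edges of `G'` (then it is the image
of its `Walk.transfer`). [folklore] -/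
theorem mem_range_rootedLoopOfLE_iff (h : G' ≤ G) {p : Σ x : Site 2, G.Walk x x} :
    p ∈ Set.range (rootedLoopOfLE h) ↔ ∀ e ∈ p.2.edges, e ∈ G'.edgeSet := by
  constructor
  · rintro ⟨⟨x, w⟩, rfl⟩ e he
    rw [rootedLoopOfLE_mk] at he
    rw [Walk.edges_mapLe_eq_edges] at he
    exact w.edges_subset_edgeSet he
  · intro hp
    obtain ⟨x, w⟩ := p
    have hp' : ∀ e ∈ (w.transfer G' hp).edges, e ∈ G.edgeSet := by
      intro e he
      rw [Walk.edges_transfer] at he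
      exact w.edges_subset_edgeSet he
    have key : (w.transfer G' hp).mapLe h = w := by
      rw [Walk.mapLe, ← Walk.transfer_eq_map_ofLE _ hp' h, Walk.transfer_transfer,
        Walk.transfer_self]
    exact ⟨⟨x, w.transfer G' hp⟩, by rw [rootedLoopOfLE_mk, key]⟩

/-- `Walk.mapLe` along `G' ≤ G` is `Walk.transfer` to `G` (Mathlib's `transfer_eq_map_ofLE`, read
backwards; the transferred walk has literally the same endpoints, which makes `length`/`support`
rewriting robust). [folklore] -/
theorem mapLe_eq_transfer (h : G' ≤ G) {u v : Site 2} (w : G'.Walk u v) :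
    w.mapLe h = w.transfer G (fun _ he => edgeSet_mono h (w.edges_subset_edgeSet he)) :=
  (Walk.transfer_eq_map_ofLE w _ h).symm

/-- The loop weight is intrinsic: a rooted loop of `G'` has the same term `m̃(l) 1{l meets W}` as a
rooted loop of `G` (same length, same support). (Lawler 2018, Def. 8.) [folklore] -/
theorem rwLoopTerm_rootedLoopOfLE (h : G' ≤ G) (W : Set (Site 2)) (q : Σ x : Site 2, G'.Walk x x) :
    rwLoopTerm G W (rootedLoopOfLE h q) = rwLoopTerm G' W q := by
  obtain ⟨x, w⟩ := q
  rw [rootedLoopOfLE_mk, mapLe_eq_transfer]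
  unfold rwLoopTerm
  simp only [Walk.support_transfer, Walk.length_transfer]

/-- Summability of the loop series passes to subgraphs. [folklore] -/
theorem summable_rwLoopTerm_of_le (h : G' ≤ G) {W : Set (Site 2)}
    (hs : Summable (rwLoopTerm G W)) : Summable (rwLoopTerm G' W) := by
  have := hs.comp_injective (rootedLoopOfLE_injective h)
  refine this.congr fun q => ?_
  exact rwLoopTerm_rootedLoopOfLE h W q

/-! ### The escaping loop mass and the splitting of the loop measure -/

/-- The **escaping loop mass** `m[{l ∈ ℒ(G; W) : l ⊄ G'}]`: the random-walk loop measure (rooted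
weight `(1/4)^{|l|}/|l|`, Lawler 2018 Def. 8/10) of the loops of `G` of positive length that meet
`W` and use at least one edge that is not an edge of `G'`. For `G' = Ω'_ε ≤ G = Ω_ε` and
`W = hit_ε γ` this is "the mass of the loops of `Ω_ε` meeting the boxes of `γ` not contained in
`Ω'_ε`" of crux `ChaosRestriction`. A real `tsum` (junk value `0` if divergent). [folklore] -/
def rwLoopMassEscaping (G G' : SimpleGraph (Site 2)) (W : Set (Site 2)) : ℝ :=
  ∑' p : (Σ x : Site 2, G.Walk x x),
    (if (0 < p.2.length ∧ (∃ v ∈ p.2.support, v ∈ W)) ∧ ¬ (∀ e ∈ p.2.edges, e ∈ G'.edgeSet) then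
      ((1 : ℝ) / 4) ^ p.2.length / (p.2.length : ℝ) else 0)

/-- The escaping-loop summand is the `G`-loop term restricted to loops not coming from `G'`.
[folklore] -/
theorem indicator_compl_range_rwLoopTerm (h : G' ≤ G) (W : Set (Site 2))
    (p : Σ x : Site 2, G.Walk x x) :
    (Set.range (rootedLoopOfLE h))ᶜ.indicator (rwLoopTerm G W) p =
      (if (0 < p.2.length ∧ (∃ v ∈ p.2.support, v ∈ W)) ∧ ¬ (∀ e ∈ p.2.edges, e ∈ G'.edgeSet) then
        ((1 : ℝ) / 4) ^ p.2.length / (p.2.length : ℝ) else 0) := by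
  by_cases h1 : ∀ e ∈ p.2.edges, e ∈ G'.edgeSet
  · have hp : p ∉ (Set.range (rootedLoopOfLE h))ᶜ := fun hn =>
      hn ((mem_range_rootedLoopOfLE_iff h).2 h1)
    rw [Set.indicator_of_notMem hp, if_neg (fun hc => hc.2 h1)]
  · have hp : p ∈ (Set.range (rootedLoopOfLE h))ᶜ := fun hn =>
      h1 ((mem_range_rootedLoopOfLE_iff h).1 hn)
    rw [Set.indicator_of_mem hp]
    unfold rwLoopTerm
    by_cases h2 : 0 < p.2.length ∧ ∃ v ∈ p.2.support, v ∈ W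
    · rw [if_pos h2, if_pos ⟨h2, h1⟩]
    · rw [if_neg h2, if_neg (fun hc => h2 hc.1)]

/-- The escaping mass is the sum of the `G`-loop terms over the loops not coming from `G'`.
[folklore] -/
theorem rwLoopMassEscaping_eq_tsum_subtype (h : G' ≤ G) (W : Set (Site 2)) :
    rwLoopMassEscaping G G' W =
      ∑' p : ↥(Set.range (rootedLoopOfLE h))ᶜ, rwLoopTerm G W p := by
  rw [tsum_subtype, rwLoopMassEscaping]
  exact tsum_congr fun p => (indicator_compl_range_rwLoopTerm h W p).symm

/-- The escaping mass is nonnegative. [folklore] -/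
theorem rwLoopMassEscaping_nonneg (G G' : SimpleGraph (Site 2)) (W : Set (Site 2)) :
    0 ≤ rwLoopMassEscaping G G' W := by
  refine tsum_nonneg fun p => ?_
  split_ifs
  · positivity
  · exact le_rfl

/-- No loop escapes from `G` itself: `m_esc(G, G; W) = 0`. [folklore] -/
@[simp] theorem rwLoopMassEscaping_self (G : SimpleGraph (Site 2)) (W : Set (Site 2)) :
    rwLoopMassEscaping G G W = 0 := by
  rw [rwLoopMassEscaping]
  refine (tsum_congr fun p => ?_).trans tsum_zero
  rw [if_neg]
  exact fun hc => hc.2 fun e he => p.2.edges_subset_edgeSet he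

/-- **Restriction property / splitting of the loop measure along a subgraph.** For `G' ≤ G` and a
convergent loop series on `G`:
`m[ℒ(G; W)] = m[ℒ(G'; W)] + m[{l ∈ ℒ(G; W) : l ⊄ G'}]` — the loops of `G` meeting `W` are the loops
of `G'` meeting `W` (same weight, Lawler 2018 Def. 8) plus the escaping ones. [folklore] -/
theorem rwLoopMass_eq_add_rwLoopMassEscaping (h : G' ≤ G) (W : Set (Site 2))
    (hs : Summable (rwLoopTerm G W)) :
    rwLoopMass G W = rwLoopMass G' W + rwLoopMassEscaping G G' W := by
  rw [rwLoopMass_eq_tsum, rwLoopMass_eq_tsum,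
    ← hs.tsum_subtype_add_tsum_subtype_compl (Set.range (rootedLoopOfLE h)),
    tsum_range _ (rootedLoopOfLE_injective h), rwLoopMassEscaping_eq_tsum_subtype h W]
  congr 1
  exact tsum_congr fun q => rwLoopTerm_rootedLoopOfLE h W q

/-- Monotonicity of the loop measure in the graph: `m[ℒ(G'; W)] ≤ m[ℒ(G; W)]` for `G' ≤ G`
(convergent series on `G`). [folklore] -/
theorem rwLoopMass_le_of_le (h : G' ≤ G) (W : Set (Site 2)) (hs : Summable (rwLoopTerm G W)) :
    rwLoopMass G' W ≤ rwLoopMass G W := by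
  rw [rwLoopMass_eq_add_rwLoopMassEscaping h W hs]
  exact le_add_of_nonneg_right (rwLoopMassEscaping_nonneg G G' W)

/-- The difference of the loop masses is the escaping mass. [folklore] -/
theorem rwLoopMass_sub_rwLoopMass_of_le (h : G' ≤ G) (W : Set (Site 2))
    (hs : Summable (rwLoopTerm G W)) :
    rwLoopMass G W - rwLoopMass G' W = rwLoopMassEscaping G G' W := by
  rw [rwLoopMass_eq_add_rwLoopMassEscaping h W hs]
  ring

/-- **Soup-void restriction covariance.** The probability that the unit random-walk loop soup on
the smaller graph `G'` has no loop meeting `W` is `exp (m_esc)` times the same probability on `G`: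
`void_{G'}(W) = exp (m[{l ∈ ℒ(G;W) : l ⊄ G'}]) · void_G(W)` (Lawler 2018 Def. 12 with the
splitting above). [folklore] -/
theorem loopSoupVoid_eq_exp_mul_of_le (h : G' ≤ G) (W : Set (Site 2))
    (hs : Summable (rwLoopTerm G W)) :
    loopSoupVoid G' W = Real.exp (rwLoopMassEscaping G G' W) * loopSoupVoid G W := by
  rw [loopSoupVoid, loopSoupVoid, ← Real.exp_add, rwLoopMass_eq_add_rwLoopMassEscaping h W hs]
  congr 1
  ring

/-- Equivalently `exp (m_G(W) − m_{G'}(W)) = exp (m_esc)`: the form matching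
`LoopAvoidance.dens_div_dens_of_hit_eq`. [folklore] -/
theorem exp_rwLoopMass_sub_of_le (h : G' ≤ G) (W : Set (Site 2))
    (hs : Summable (rwLoopTerm G W)) :
    Real.exp (rwLoopMass G W - rwLoopMass G' W) = Real.exp (rwLoopMassEscaping G G' W) := by
  rw [rwLoopMass_sub_rwLoopMass_of_le h W hs]

end Literature.Probability.LatticeModels
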